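import Summits.CriticalPhenomena.PercolationContinuityZ3.Theorems.PercNearOneGluingNoHeavyQuantFarTreeRowOfTreeBuilt
import HarnessLib

/-!
# QUANT lane R8 — THE FLOOR SPLIT OF THE BRIDGE: `Quant.FarTreeRow` from the heavy-regime forest row (`t < 1/2`) and the
# law-level far-relay row for tree-built laws at floors `x < 1/2`

builds on p205010 (kernel theorem, internal audit signed; external expert review pending)

Support file (`--supports stmt-CriticalPhenomena-4575`), QUANT lane typer seat prim-quant-stmt (gen 35).  Theorems only, no definitions,
no sorries, standard axioms.  This is the ASSEMBLY node of the two-regime architecture of rung R8 (`run/shared/lean/prim/quant/LADDER.md`,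
`STATEMENTS.md` §AO–§AP): the heavy half of `Quant.FarTreeRow` (all relay marginals `> 1/2`, i.e. `t < 1/2`) is attacked at forest level
(lead g37's `FarTreeRowHeavy`, reduced to the depth-0 node `TLBGateConvClosedHeavy` / Conjecture R), the light half at law level
(`LawDec.TreeBuilt x M μ` with `x < 1/2`: census-2's `SDECConvClosed`, the typer's `GatedPairHull`).  The bridge
`Quant.farTreeRow_of_treeBuilt_rows` (`…QuantFarTreeRowOfTreeBuilt`) takes the law-level row at EVERY floor; here it is split:

* **`Quant.farTreeRow_of_heavy_and_lightRows`** — if the forest row holds whenever `t < 1/2` (the statement of `FarTreeRowHeavy`, inlined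
  verbatim so that no new `Prop` is introduced; when that definition lands the hypothesis is it by `rfl`), and every tree-built law at a
  floor `x < 1/2` with `2j < mean` has `x ≤ μ{j+1..M}`, then `Quant.FarTreeRow`.  Proof: for `t < 1/2` use the heavy hypothesis; for
  `t ≥ 1/2` every floor `x < 1 − t` is `< 1/2`, and the bridge argument (`ForestLaw.treeBuilt_law`, mean = Σ marginals, density) runs with
  the light rows only.
* `Quant.farTreeRow_of_treeBuilt_rows_split` — the purely law-level split (rows for tree-built laws at `x < 1/2` and at `1/2 ≤ x`
  separately) — a one-line case split over `farTreeRow_of_treeBuilt_rows`, recorded for the provers' convenience.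

HONEST STATUS: both hypotheses are OPEN conjectures of this lane (`FarTreeRowHeavy`: kernel-in-scratch ×3, by-name files pending farm
builds; the light law-level row: `GatedPairHull` / `SDECConvClosed`, open); `Quant.FarTreeRow` remains OPEN.  Nothing here is a published
result. [this work]; product measure [cite: Grimmett1999, §1.3 p. 10]; the gluing rows served [cite: KozmaNitzan2024, Conjecture 3 (p. 15)].
-/

noncomputable section

namespace Summit.CriticalPhenomena.PercolationContinuityZ3.Theorems

namespace Quant

section Split

open Finset MeasureTheory
open Literature.Probability.LatticeModels
open Literature.Probability.Percolation
open scoped Classical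

/-- **THE FLOOR SPLIT OF THE BRIDGE.**  `Quant.FarTreeRow` follows from (heavy) the forest row under the extra hypothesis `t < 1/2` —
literally the body of lead g37's `FarTreeRowHeavy` — and (light) the law-level far-relay row `2j < mean ⟹ x ≤ μ{j+1..M}` for every
tree-built law `LawDec.TreeBuilt x M μ` at a floor `x < 1/2`.  For `t ≥ 1/2` every admissible floor `x < 1 − t` is `< 1/2`, so the bridge
argument of `farTreeRow_of_treeBuilt_rows` needs the light rows only. [this work] -/
theorem farTreeRow_of_heavy_and_lightRows
    (hH : ∀ (m : ℕ) (P : Fin m → Finset (Fin m)),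
      (∀ x, x ∈ P x) → (∀ x, ∀ y ∈ P x, P y ⊆ P x) → (∀ x, ∀ y ∈ P x, ∀ z ∈ P x, y ∈ P z ∨ z ∈ P y) →
      ∀ (q : Fin m → unitInterval) (A : Finset (Fin m)) (j : ℕ) (t : ℝ),
        t < 1 / 2 →
        (2 * j : ℝ) < ∑ a ∈ A, ∏ y ∈ P a, (q y : ℝ) →
        (∀ a ∈ A, 1 - ∏ y ∈ P a, (q y : ℝ) ≤ t) →
        (prodBernoulli q).real {ω : Set (Fin m) | (A.filter fun a => ((P a : Finset (Fin m)) : Set (Fin m)) ⊆ ω).card ≤ j} ≤ t)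
    (hL : ∀ (x : ℝ) (M : ℕ) (μ : ℕ → ℝ), LawDec.TreeBuilt x M μ → x < 1 / 2 → ∀ j : ℕ,
      (2 * j : ℝ) < ∑ h ∈ Finset.range (M + 1), (h : ℝ) * μ h → x ≤ ∑ h ∈ Finset.Ico (j + 1) (M + 1), μ h) :
    FarTreeRow := by
  intro m P hrefl htrans hchain q A j t hbudget hmarg
  by_cases ht : t < 1 / 2
  · exact hH m P hrefl htrans hchain q A j t ht hbudget hmarg
  · have ht' : 1 - t ≤ 1 / 2 := by linarith [le_of_not_gt ht]
    -- mean of the count law = sum of the marginals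
    have hmean : ∑ h ∈ Finset.range (A.card + 1), (h : ℝ) *
        (prodBernoulli q).real {ω : Set (Fin m) | (A.filter fun a => ((P a : Finset (Fin m)) : Set (Fin m)) ⊆ ω).card = h} =
        ∑ a ∈ A, ∏ y ∈ P a, (q y : ℝ) := by
      have e := RootDecGate.sum_mul_real_Nk_eq q A P (fun _ => ()) ()
      simp only [Finset.filter_true] at e
      exact e
    -- tail of the count law = the heavy event
    have htail : ∑ h ∈ Finset.Ico (j + 1) (A.card + 1),
        (prodBernoulli q).real {ω : Set (Fin m) | (A.filter fun a => ((P a : Finset (Fin m)) : Set (Fin m)) ⊆ ω).card = h} =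
        (prodBernoulli q).real {ω : Set (Fin m) | j + 1 ≤ (A.filter fun a => ((P a : Finset (Fin m)) : Set (Fin m)) ⊆ ω).card} := by
      have key := sum_measureReal_preimage_singleton (μ := prodBernoulli q) (Finset.Ico (j + 1) (A.card + 1))
        (f := fun ω : Set (Fin m) => (A.filter fun a => ((P a : Finset (Fin m)) : Set (Fin m)) ⊆ ω).card)
        (fun _ _ => MeasurableSet.of_discrete)
      have hpre : (fun ω : Set (Fin m) => (A.filter fun a => ((P a : Finset (Fin m)) : Set (Fin m)) ⊆ ω).card) ⁻¹'
          (↑(Finset.Ico (j + 1) (A.card + 1)) : Set ℕ) =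
          {ω : Set (Fin m) | j + 1 ≤ (A.filter fun a => ((P a : Finset (Fin m)) : Set (Fin m)) ⊆ ω).card} := by
        ext ω
        simp only [Set.mem_preimage, Finset.coe_Ico, Set.mem_Ico, Set.mem_setOf_eq]
        exact ⟨fun h => h.1, fun h => ⟨h, Nat.lt_succ_of_le (Finset.card_filter_le _ _)⟩⟩
      rw [hpre] at key
      exact key
    -- some relay exists (the budget is positive)
    have hA : A.Nonempty := by
      rw [Finset.nonempty_iff_ne_empty]
      rintro rfl
      rw [Finset.sum_empty] at hbudget
      have : (0 : ℝ) ≤ 2 * j := by positivity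
      linarith
    obtain ⟨a₀, ha₀⟩ := hA
    rw [RootDecGate.real_light_eq_one_sub]
    suffices key : 1 - t ≤ (prodBernoulli q).real
        {ω : Set (Fin m) | j + 1 ≤ (A.filter fun a => ((P a : Finset (Fin m)) : Set (Fin m)) ⊆ ω).card} by linarith
    rw [← htail]
    refine le_of_forall_lt_imp_le_of_dense fun x hx => ?_
    by_cases hx0 : x ≤ 0
    · exact hx0.trans (Finset.sum_nonneg fun h _ => measureReal_nonneg)
    · have hx0' : 0 < x := lt_of_not_ge hx0
      have hxhalf : x < 1 / 2 := lt_of_lt_of_le hx ht'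
      have hfloor : ∀ a ∈ A, x < ∏ y ∈ P a, (q y : ℝ) := fun a ha => by linarith [hmarg a ha]
      have hx1 : x < 1 := by linarith
      have hT := ForestLaw.treeBuilt_law q P htrans hchain A x hx0' hx1 hfloor
      exact hL x A.card _ hT hxhalf j (by rw [hmean]; exact hbudget)

/-- **The purely law-level floor split**: if the far-relay row `2j < mean ⟹ x ≤ μ{j+1..M}` holds for every tree-built law at floors
`x < 1/2` and, separately, at floors `1/2 ≤ x`, then `Quant.FarTreeRow` (case split inside `farTreeRow_of_treeBuilt_rows`). [this work] -/
theorem farTreeRow_of_treeBuilt_rows_split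
    (hL : ∀ (x : ℝ) (M : ℕ) (μ : ℕ → ℝ), LawDec.TreeBuilt x M μ → x < 1 / 2 → ∀ j : ℕ,
      (2 * j : ℝ) < ∑ h ∈ Finset.range (M + 1), (h : ℝ) * μ h → x ≤ ∑ h ∈ Finset.Ico (j + 1) (M + 1), μ h)
    (hH : ∀ (x : ℝ) (M : ℕ) (μ : ℕ → ℝ), LawDec.TreeBuilt x M μ → 1 / 2 ≤ x → ∀ j : ℕ,
      (2 * j : ℝ) < ∑ h ∈ Finset.range (M + 1), (h : ℝ) * μ h → x ≤ ∑ h ∈ Finset.Ico (j + 1) (M + 1), μ h) :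
    FarTreeRow :=
  farTreeRow_of_treeBuilt_rows fun x M μ hT j hdom =>
    (lt_or_ge x (1 / 2)).elim (fun hx => hL x M μ hT hx j hdom) (fun hx => hH x M μ hT hx j hdom)

end Split

end Quant

end Summit.CriticalPhenomena.PercolationContinuityZ3.Theorems
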